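import Literature.NumberTheory.Automorphic.UnitaryGroupTruncatedKernelClassSumOfSupport
import Literature.NumberTheory.Automorphic.UnitaryGroupTruncatedKernelClassHighCuspTwo
import Literature.NumberTheory.Automorphic.UnitaryGroupTruncatedKernelMeasurableTwo
import HarnessLib

/-!
# The `𝔬`-expansion of Arthur's truncated kernel on `U(J₂)` is a FINITE sum for `f ∈ C_c`:
# `k^T(x) = Σ_{𝔬 ∈ S} k^T_𝔬(x)` and `J^T(f) = Σ_{𝔬 ∈ S} J^T_𝔬(f)` — the class-first glue in two variables
(Rogawski, *Automorphic Representations of Unitary Groups in Three Variables* (1990), §2.2–2.3 pp. 13–14 «Clearly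
`K_P = Σ_𝔬 K_{P,𝔬}` … then (2.1.1) is equal to `Σ J^T_𝔬(f)`», for the rank-one groups `U(3)`, `U(2)`, `U(2) × U(1)`
of §7.3 p. 98; Shokranian, *The Selberg–Arthur Trace Formula* (1992), §5.2; Arthur, Duke Math. J. 45 (1978), §7.)

Topic `NumberTheory/Automorphic`; namespace `Literature.NumberTheory.Automorphic.UnitaryGroup`. THEOREMS ONLY over
accepted tree modules: no definition, no named fact, no instance, no notation, no `sorry`. The `N = 2` sibling of the
`section Three` heads of ★ `UnitaryGroupTruncatedKernelClassSumOfSupport` (whose `section General` — the `K`-side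
`kernel_eq_sum_kernelClass_of_tsupport` and the Borel-sum side `borelSum_eq_sum_borelSumClass_of_tsupport`, every `N` —
is USED). H-SIDE copy of LAWS 1–5 (`H = U(Φ₂) × U(Φ₁)`; LEAD WORDs #123∕#124; census
`CENSUS-LAWS-Hside.F0P3a-p03g6.md` Q5 «class rows FIRST, the totals as the finite class sum») of the T1 line
`Cruxes/H413/Lines/F0_T1InnerFormTraceIdentity.lean` (cell `pub/hodgecm-mathlib`, crux H413): THIS is the file that
turns the per-class rows of the `N = 2` road (per-class integrability, per-class `A log T + B`) into LAW 1 and LAW 2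
for `U(J₂)` by summation.

* §2 `kernelBorel_diag_eq_sum_kernelBorelClass_of_tsupport_two` — `K_B(y, y) = Σ_{𝔬 ∈ S} K_{B,𝔬}(y, y)`;
* §3 **`truncatedKernel_eq_sum_truncatedKernelClass_of_tsupport_two`** — `k^T(x) = Σ_{𝔬 ∈ S} k^T_𝔬(x)` at every `x`;
* §4 **`truncatedTrace_eq_sum_truncatedTraceClass_of_tsupport_two`** — `J^T(f) = Σ_{𝔬 ∈ S} J^T_𝔬(f)` given per-class
  integrability, and **`integrable_quotFun_truncatedKernel_of_forall_class_two`** — `k^T` is integrable on the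
  automorphic quotient as soon as its finitely many live class parts are.

## References

* J. D. Rogawski, *Automorphic Representations of Unitary Groups in Three Variables*, Ann. of Math. Stud. 123 (1990),
  §2.2–2.3 (pp. 13–14), §7.3 (p. 98) [Rogawski1990].
* S. Shokranian, *The Selberg–Arthur Trace Formula*, LNM 1503 (1992), §5.2 [Shokranian1992].
-/

set_option autoImplicit false

noncomputable section

open MeasureTheory Measure NumberField IsDedekindDomain Matrix Topology
open scoped NNReal ENNReal MatrixGroups

namespace Literature.NumberTheory.Automorphic

namespace UnitaryGroup

variable {F E : Type} [Field F] [NumberField F] [Field E] [NumberField E] [Algebra F E]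
  {c : E ≃ₐ[F] E} {ι : Type*}

section Two

variable [MeasurableSpace (adelicUnipotent F E c 2)] [BorelSpace (adelicUnipotent F E c 2)]

/-! ## §2 The Borel diagonal: `K_B(y, y) = Σ_{𝔬 ∈ S} K_{B,𝔬}(y, y)` -/

/-- **`K_B(y, y) = Σ_{𝔬 ∈ S} K_{B,𝔬}(y, y)`** on `U(J₂)` («Clearly `K_P = Σ_𝔬 K_{P,𝔬}`», `P = B`, on the diagonal): for a Haar
measure `ν` on `N(𝔸_F)`, a fundamental domain `𝓕` of `N(F)` inside a compact `U`, `f ∈ C_c(U(J₂)(𝔸_F))`, and every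
finite `S` containing the class of each `β ∈ B(F)` with `y⁻¹ β u y ∈ supp f` for some `u ∈ U`. The Borel constant term
integrates `u ↦ Σ_β f(y⁻¹ β u y)` over `𝓕 ⊆ U` only, where ★ `borelSum_eq_sum_borelSumClass_of_tsupport` decomposes it
class by class; each class Borel sum is integrable there (★ `integrableOn_borelSumClass_translate_two`), so the integral
of the finite sum is the sum of the integrals. [cite: Rogawski1990, §2.2 (p. 13)] -/
theorem kernelBorel_diag_eq_sum_kernelBorelClass_of_tsupport_two (ν : Measure (adelicUnipotent F E c 2))
    [ν.IsHaarMeasure] {𝓕 U : Set (adelicUnipotent F E c 2)}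
    (h𝓕 : IsFundamentalDomain (rationalUnipotent F E c 2) 𝓕 ν) (hU : IsCompact U) (h𝓕U : 𝓕 ⊆ U)
    (cl : (quasiSplit F E c 2).arithmeticSubgroup → ι) {f : (quasiSplit F E c 2).Adelic → ℂ}
    (hfc : Continuous f) (hf : HasCompactSupport f) (S : Finset ι) {y : (quasiSplit F E c 2).Adelic}
    (hSB : ∀ (β : arithmeticBorel F E c 2) (u : adelicUnipotent F E c 2), u ∈ U →
      y⁻¹ * (((β : (quasiSplit F E c 2).arithmeticSubgroup)) : (quasiSplit F E c 2).Adelic) *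
        ((u : (quasiSplit F E c 2).Adelic) * y) ∈ tsupport f → cl β ∈ S) :
    kernelBorel ν 𝓕 f y y = ∑ i ∈ S, kernelBorelClass ν 𝓕 cl i f y y := by
  simp only [kernelBorelClass_eq_smul_integral_two]
  rw [kernelBorel_eq_smul_integral, ← Finset.smul_sum,
    ← integral_finsetSum S fun i _ => integrableOn_borelSumClass_translate_two ν hU h𝓕U cl i hfc hf y]
  congr 1
  refine setIntegral_congr_fun₀ h𝓕.nullMeasurableSet fun u hu => ?_
  exact borelSum_eq_sum_borelSumClass_of_tsupport hf cl S fun β hβ => hSB β u (h𝓕U hu) hβ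

/-! ## §3 The truncated kernel: `k^T(x) = Σ_{𝔬 ∈ S} k^T_𝔬(x)` -/

/-- **`k^T(x) = Σ_{𝔬 ∈ S} k^T_𝔬(x)` at every `x`** on `U(J₂)` («Then `k^T(x) = Σ_𝔬 k^T_𝔬(x)`»): for a Haar measure `ν` on
`N(𝔸_F)`, a fundamental domain `𝓕` of `N(F)` inside a compact `U`, `f ∈ C_c(U(J₂)(𝔸_F))`, `T > 0`, every class map `cl` and
every finite `S` carrying (i) the class of each `γ ∈ G(F)` a conjugate of which meets `supp f` and (ii) the class of each
`β ∈ B(F)` with `y⁻¹ β u y ∈ supp f` for some `u ∈ U`, `y ∈ G(𝔸_F)`. Assembly of ★ `truncatedKernel_eq_sum_truncatedKernelClass`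
(every `N`) over ★ `kernel_eq_sum_kernelClass_of_tsupport` (the `K`-side), §2 (the `K_B`-side at every `y`) and ★
`finite_support_kernelBorelTailClass_translate_two` (each class `δ`-sum is finite). [cite: Rogawski1990, §2.2 (p. 13)]
[cite: Shokranian1992, §5.2] -/
theorem truncatedKernel_eq_sum_truncatedKernelClass_of_tsupport_two (ν : Measure (adelicUnipotent F E c 2))
    [ν.IsHaarMeasure] {𝓕 U : Set (adelicUnipotent F E c 2)}
    (h𝓕 : IsFundamentalDomain (rationalUnipotent F E c 2) 𝓕 ν) (hU : IsCompact U) (h𝓕U : 𝓕 ⊆ U)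
    (cl : (quasiSplit F E c 2).arithmeticSubgroup → ι) {f : (quasiSplit F E c 2).Adelic → ℂ}
    (hfc : Continuous f) (hf : HasCompactSupport f) (S : Finset ι) {T : ℝ≥0} (hT : 0 < T)
    (hS : ∀ (γ : (quasiSplit F E c 2).arithmeticSubgroup) (x : (quasiSplit F E c 2).Adelic),
      x⁻¹ * (γ : (quasiSplit F E c 2).Adelic) * x ∈ tsupport f → cl γ ∈ S)
    (hSB : ∀ (β : arithmeticBorel F E c 2) (u : adelicUnipotent F E c 2) (y : (quasiSplit F E c 2).Adelic),
      u ∈ U → y⁻¹ * (((β : (quasiSplit F E c 2).arithmeticSubgroup)) : (quasiSplit F E c 2).Adelic) *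
        ((u : (quasiSplit F E c 2).Adelic) * y) ∈ tsupport f → cl β ∈ S)
    (x : (quasiSplit F E c 2).Adelic) :
    truncatedKernel ν 𝓕 T f x = ∑ i ∈ S, truncatedKernelClass ν 𝓕 T cl i f x :=
  truncatedKernel_eq_sum_truncatedKernelClass T cl S
    (kernel_eq_sum_kernelClass_of_tsupport hf cl S fun γ hγ => hS γ x hγ)
    (fun y => kernelBorel_diag_eq_sum_kernelBorelClass_of_tsupport_two ν h𝓕 hU h𝓕U cl hfc hf S
      fun β u hu hβ => hSB β u y hu hβ)
    (fun i _ => finite_support_kernelBorelTailClass_translate_two ν 𝓕 hT cl i f x)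

/-! ## §4 The distribution: `J^T(f) = Σ_{𝔬 ∈ S} J^T_𝔬(f)`; integrability of `k^T` from its class parts -/

/-- **`J^T(f) = Σ_{𝔬 ∈ S} J^T_𝔬(f)`** on `U(J₂)` («Then (2.1.1) is equal to `Σ J^T_𝔬(f)`»): under the hypotheses of §3, for every
measure `μ` on the automorphic quotient against which each descended `k^T_𝔬`, `𝔬 ∈ S`, is integrable (the per-class
integrability theorem of the `N = 2` road, a hypothesis here), Arthur's distribution is the finite sum of its class
parts (★ `truncatedTrace_eq_sum_truncatedTraceClass`, every `N`). [cite: Rogawski1990, §2.2 (p. 13)] [cite: Shokranian1992, §5.2] -/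
theorem truncatedTrace_eq_sum_truncatedTraceClass_of_tsupport_two (ν : Measure (adelicUnipotent F E c 2))
    [ν.IsHaarMeasure] {𝓕 U : Set (adelicUnipotent F E c 2)}
    (h𝓕 : IsFundamentalDomain (rationalUnipotent F E c 2) 𝓕 ν) (hU : IsCompact U) (h𝓕U : 𝓕 ⊆ U)
    (cl : (quasiSplit F E c 2).arithmeticSubgroup → ι) {f : (quasiSplit F E c 2).Adelic → ℂ}
    (hfc : Continuous f) (hf : HasCompactSupport f) (S : Finset ι) {T : ℝ≥0} (hT : 0 < T)
    (hS : ∀ (γ : (quasiSplit F E c 2).arithmeticSubgroup) (x : (quasiSplit F E c 2).Adelic),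
      x⁻¹ * (γ : (quasiSplit F E c 2).Adelic) * x ∈ tsupport f → cl γ ∈ S)
    (hSB : ∀ (β : arithmeticBorel F E c 2) (u : adelicUnipotent F E c 2) (y : (quasiSplit F E c 2).Adelic),
      u ∈ U → y⁻¹ * (((β : (quasiSplit F E c 2).arithmeticSubgroup)) : (quasiSplit F E c 2).Adelic) *
        ((u : (quasiSplit F E c 2).Adelic) * y) ∈ tsupport f → cl β ∈ S)
    (μ : Measure (quasiSplit F E c 2).automorphicQuotient)
    (hint : ∀ i ∈ S,
      Integrable ((quasiSplit F E c 2).quotFun (truncatedKernelClass ν 𝓕 T cl i f)) μ) :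
    truncatedTrace μ ν 𝓕 T f = ∑ i ∈ S, truncatedTraceClass μ ν 𝓕 T cl i f :=
  truncatedTrace_eq_sum_truncatedTraceClass μ T cl S
    (fun x => truncatedKernel_eq_sum_truncatedKernelClass_of_tsupport_two ν h𝓕 hU h𝓕U cl hfc hf S hT hS hSB x)
    hint

/-- **`k^T` of `U(J₂)` is integrable on the automorphic quotient as soon as its finitely many live class parts are** (under
the hypotheses of §3): the descended `k^T` is the finite sum of the descended `k^T_𝔬`, `𝔬 ∈ S` — the converse bookkeeping
of the `𝔬`-expansion (Arthur (1978), Thm. 7.1 is stated per class; the `N = 2` LAW 1 «`k^T` integrable» IS this sum over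
the per-class rows, census Q5). [cite: Rogawski1990, §2.2 (p. 13)] [cite: Shokranian1992, §5.2] -/
theorem integrable_quotFun_truncatedKernel_of_forall_class_two (ν : Measure (adelicUnipotent F E c 2))
    [ν.IsHaarMeasure] {𝓕 U : Set (adelicUnipotent F E c 2)}
    (h𝓕 : IsFundamentalDomain (rationalUnipotent F E c 2) 𝓕 ν) (hU : IsCompact U) (h𝓕U : 𝓕 ⊆ U)
    (cl : (quasiSplit F E c 2).arithmeticSubgroup → ι) {f : (quasiSplit F E c 2).Adelic → ℂ}
    (hfc : Continuous f) (hf : HasCompactSupport f) (S : Finset ι) {T : ℝ≥0} (hT : 0 < T)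
    (hS : ∀ (γ : (quasiSplit F E c 2).arithmeticSubgroup) (x : (quasiSplit F E c 2).Adelic),
      x⁻¹ * (γ : (quasiSplit F E c 2).Adelic) * x ∈ tsupport f → cl γ ∈ S)
    (hSB : ∀ (β : arithmeticBorel F E c 2) (u : adelicUnipotent F E c 2) (y : (quasiSplit F E c 2).Adelic),
      u ∈ U → y⁻¹ * (((β : (quasiSplit F E c 2).arithmeticSubgroup)) : (quasiSplit F E c 2).Adelic) *
        ((u : (quasiSplit F E c 2).Adelic) * y) ∈ tsupport f → cl β ∈ S)
    (μ : Measure (quasiSplit F E c 2).automorphicQuotient)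
    (hint : ∀ i ∈ S,
      Integrable ((quasiSplit F E c 2).quotFun (truncatedKernelClass ν 𝓕 T cl i f)) μ) :
    Integrable ((quasiSplit F E c 2).quotFun (truncatedKernel ν 𝓕 T f)) μ := by
  have h : (quasiSplit F E c 2).quotFun (truncatedKernel ν 𝓕 T f) =
      ∑ i ∈ S, (quasiSplit F E c 2).quotFun (truncatedKernelClass ν 𝓕 T cl i f) := by
    funext q
    simp only [AdelicGroupData.quotFun, Finset.sum_apply]
    exact truncatedKernel_eq_sum_truncatedKernelClass_of_tsupport_two ν h𝓕 hU h𝓕U cl hfc hf S hT hS hSB _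
  rw [h]
  exact integrable_finsetSum' S hint

end Two

end UnitaryGroup

end Literature.NumberTheory.Automorphic
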